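import Literature.NumberTheory.Automorphic.EichlerEmbeddingLocalLevel
import Literature.NumberTheory.Automorphic.RamifiedPrimeIdeal
import HarnessLib

/-!
# Local optimal embedding numbers at a ramified prime: `m_p(B) = [B_p maximal] · (1 - (B/p))`
# (Vignéras LNM 800 Ch. II §1, §3; Eichler 1955 Satz 7)

Topic `NumberTheory/Automorphic`; definitions with bodies and theorems (no named fact, no
`sorry`). Fifth brick of the Brandt-module side of the Eichler–Pizer trace identity: the local
embedding numbers `m_p = localEmbeddingNumber O γ B p` of `EichlerEmbeddingLocalGlobal.lean` at a
prime `p` at which the quaternion algebra `D` is **ramified** (`ℚ_p ⊗ D` a division algebra) and the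
order `O` is maximal at `p` (`O_(p) = {x : nrd x, trd x ∈ ℤ_(p)}`; every Eichler order,
`maximalAtP_inf`).

For an order `B ∋ γ` of `ℚ(γ)` with `ℤ`-basis `(1, σ₀)`, `σ₀² = t_B σ₀ - n_B`:

* `RamHyp.localEmbeddingNumber_eq` —
  `m_p(B) = 0` if `∃ k, p ∣ t_B + 2k ∧ p² ∣ k² + t_B k + n_B` (`B_p` not maximal), and otherwise
  `m_p(B) = 2 - #{k mod p : p ∣ k² + t_B k + n_B}` (`= 2` for `p` inert in `ℚ(γ)`, `= 1` for `p`
  ramified; `p` cannot split since `ℚ(γ)_p ⊆ D_p` is a field), i.e. Eichler's `1 - {B/p}`.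

## Proof (Vignéras II §1 Lemme 1.4–1.5, §3)

`O_p` is the valuation ring `{w ∘ nrd ≥ 0}` of the local division algebra, so the local ideals are
`x O_(p) = {y : |nrd y|_p ≤ |nrd x|_p}` (`mem_smul_localAt_iff`), all with left order `O_(p)`
(`leftOrder_smul_localAt`) and optimal order `O_(p) ∩ ℚ(γ)`, the `p`-maximal order of `ℚ(γ)`
(`smul_localAt_mem_localIdeals_iff`). Hence `m_p(B) = 0` unless `B_(p) = O_(p) ∩ ℚ(γ)`, which in
the coordinates `(1, σ₀)` reads `¬ ∃ k, p ∣ t_B + 2k ∧ p² ∣ N(σ₀ + k)` (`inf_adjoinLattice_eq_iff`);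
and then the classes modulo `ℚ(γ)ˣ` are the cosets of `|nrd ℚ(γ)ˣ|_p` in `|nrd Dˣ|_p = p^ℤ`
(a uniformiser exists, `exists_uniformiser`): one class if some `c ∈ ℚ(γ)ˣ` has `|N c|_p = p⁻¹`
(`p` ramified in `ℚ(γ)`: `p ∣ N(σ₀ + k)` for some `k`, `localEmbeddingNumber_eq_one`), two
otherwise (`localEmbeddingNumber_eq_two`). Throughout, "`nrd` integral ⇒ `trd` integral"
(Lemme 1.4, `not_dvd_den_reducedTrace_of_not_dvd_den_reducedNorm`) replaces the valuation theory.

## References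

* M.-F. Vignéras, *Arithmétique des algèbres de quaternions*, LNM 800 (1980), Ch. II §1
  Lemme 1.4–1.5, §3; Ch. III §5 Thm. 5.11–Cor. 5.12 [VignerasLNM800].
* M. Eichler, *Zur Zahlentheorie der Quaternionen-Algebren*, J. reine angew. Math. 195 (1955),
  Satz 7 [Eichler1955].
* H. Hijikata, *Explicit formula of the traces of Hecke operators for `Γ₀(N)`*, J. Math. Soc.
  Japan 26 (1974), §2 [Hijikata1974].
-/

noncomputable section

open scoped Pointwise

universe u

namespace Literature.NumberTheory.Automorphic

namespace Brandt

open Literature.NumberTheory.QuadraticFields.PadicQuadratic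
open scoped QuadraticAlgebra

/-! ### Integer form of the local data of a quadratic generator `σ`, `tr σ = t`, `N σ = n` -/

section Generic

variable {q : ℕ} [hq : Fact q.Prime] {a b : ℚ_[q]}

/-- `N(σ + k) = k² + t k + n`. [folklore] -/
theorem norm_add_intCast_smul_one {σ : QuadraticAlgebra ℚ_[q] a b} {t n : ℤ} (ht : tr σ = t)
    (hn : σ.norm = n) (k : ℤ) : (σ + (k : ℚ_[q]) • 1).norm = ((k ^ 2 + t * k + n : ℤ) : ℚ_[q]) := by
  rw [norm_add_smul_one, ht, hn]; push_cast; ring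

/-- `tr(σ + k) = t + 2k`. [folklore] -/
theorem tr_add_intCast_smul_one {σ : QuadraticAlgebra ℚ_[q] a b} {t : ℤ} (ht : tr σ = t) (k : ℤ) :
    tr (σ + (k : ℚ_[q]) • 1) = ((t + 2 * k : ℤ) : ℚ_[q]) := by
  rw [tr_add_smul_one, ht]; push_cast; ring

/-- **`q ∣ N(σ + k) ↔ q ∣ k² + t k + n`.** [folklore] -/
theorem norm_norm_add_natCast_lt_one_iff {σ : QuadraticAlgebra ℚ_[q] a b} {t n : ℤ} (ht : tr σ = t)
    (hn : σ.norm = n) (k : ℕ) :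
    ‖(σ + (k : ℚ_[q]) • 1).norm‖ < 1 ↔ (q : ℤ) ∣ (k : ℤ) ^ 2 + t * k + n := by
  rw [show ((k : ℚ_[q])) = ((k : ℤ) : ℚ_[q]) by simp, norm_add_intCast_smul_one ht hn,
    Padic.norm_intCast_lt_one_iff]

/-- Shifting by a `q`-adically small amount keeps `q ∣ N`. [folklore] -/
theorem norm_norm_add_smul_one_lt_one_of_sub {σ : QuadraticAlgebra ℚ_[q] a b} {t : ℤ} (ht : tr σ = t)
    {k k' : ℚ_[q]} (hk : ‖k‖ ≤ 1) (hk' : ‖k'‖ ≤ 1) (hN : ‖(σ + k • 1).norm‖ < 1)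
    (hkk' : ‖k - k'‖ < 1) : ‖(σ + k' • 1).norm‖ < 1 := by
  have htr : ‖tr σ‖ ≤ 1 := by rw [ht]; exact Padic.norm_int_le_one _
  have e : (σ + k' • 1).norm = (σ + k • 1).norm + (k' - k) * (tr σ + k + k') := by
    rw [norm_add_smul_one, norm_add_smul_one]; ring
  rw [e]
  refine lt_of_le_of_lt (Padic.nonarchimedean _ _) (max_lt hN ?_)
  rw [norm_mul, ← norm_neg, neg_sub]
  refine mul_lt_one_of_nonneg_of_lt_one_left (norm_nonneg _) hkk' ?_
  exact (Padic.nonarchimedean _ _).trans (max_le ((Padic.nonarchimedean _ _).trans (max_le htr hk)) hk')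

/-- **From `q`-adic to integral non-maximality**: if `tr(σ + k) ∈ q ℤ_q` and `N(σ + k) ∈ q² ℤ_q`
for some `k ∈ ℤ_q`, then the same holds for an integer `k`. [folklore] -/
theorem exists_int_nonmax_of_padic {σ : QuadraticAlgebra ℚ_[q] a b} {t n : ℤ} (ht : tr σ = t)
    (hn : σ.norm = n) {k : ℚ_[q]} (hk : ‖k‖ ≤ 1) (htr : ‖tr (σ + k • 1)‖ ≤ (q : ℝ)⁻¹)
    (hN : ‖(σ + k • 1).norm‖ ≤ ((q : ℝ) ^ 2)⁻¹) :
    ∃ k₁ : ℤ, (q : ℤ) ∣ t + 2 * k₁ ∧ (q : ℤ) ^ 2 ∣ k₁ ^ 2 + t * k₁ + n := by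
  have hq1 : (1 : ℝ) ≤ q := by exact_mod_cast hq.out.one_lt.le
  have hq0 : (0 : ℝ) < q := by exact_mod_cast hq.out.pos
  have hpow2 : (q : ℝ) ^ (-((2 : ℕ) : ℤ)) = ((q : ℝ) ^ 2)⁻¹ := by rw [zpow_neg, zpow_natCast]
  have hpow1 : (q : ℝ) ^ (-((1 : ℕ) : ℤ)) = (q : ℝ)⁻¹ := by rw [zpow_neg, Nat.cast_one, zpow_one]
  obtain ⟨n₁, -, hn₁⟩ := exists_nat_norm_sub_le hk 2
  rw [hpow2] at hn₁
  have hn₁' : ‖(n₁ : ℚ_[q]) - k‖ ≤ ((q : ℝ) ^ 2)⁻¹ := by rwa [← norm_neg, neg_sub]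
  have hq2 : ((q : ℝ) ^ 2)⁻¹ ≤ (q : ℝ)⁻¹ := by
    rw [inv_le_inv₀ (pow_pos hq0 2) hq0]
    exact le_self_pow₀ hq1 two_ne_zero
  refine ⟨n₁, ?_, ?_⟩
  · have e : tr (σ + ((n₁ : ℤ) : ℚ_[q]) • 1) = tr (σ + k • 1) + 2 * ((n₁ : ℚ_[q]) - k) := by
      rw [tr_add_smul_one, tr_add_smul_one]; push_cast; ring
    have h : ‖tr (σ + ((n₁ : ℤ) : ℚ_[q]) • 1)‖ ≤ (q : ℝ) ^ (-((1 : ℕ) : ℤ)) := by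
      rw [hpow1, e]
      refine (Padic.nonarchimedean _ _).trans (max_le htr ?_)
      rw [norm_mul]
      calc ‖(2 : ℚ_[q])‖ * ‖(n₁ : ℚ_[q]) - k‖ ≤ 1 * (q : ℝ)⁻¹ :=
            mul_le_mul norm_two_le_one (hn₁'.trans hq2) (norm_nonneg _) zero_le_one
        _ = (q : ℝ)⁻¹ := one_mul _
    rw [tr_add_intCast_smul_one ht, Padic.norm_int_le_pow_iff_dvd, pow_one] at h
    exact h
  · have e : (σ + ((n₁ : ℤ) : ℚ_[q]) • 1).norm =
        (σ + k • 1).norm + ((n₁ : ℚ_[q]) - k) * (tr (σ + k • 1) + ((n₁ : ℚ_[q]) - k)) := by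
      rw [norm_add_smul_one, norm_add_smul_one, tr_add_smul_one]; push_cast; ring
    have htr1 : ‖tr (σ + k • 1) + ((n₁ : ℚ_[q]) - k)‖ ≤ 1 :=
      (Padic.nonarchimedean _ _).trans (max_le (htr.trans (inv_le_one_of_one_le₀ hq1))
        (hn₁'.trans ((inv_le_one_of_one_le₀ (one_le_pow₀ hq1)))))
    have h : ‖(σ + ((n₁ : ℤ) : ℚ_[q]) • 1).norm‖ ≤ (q : ℝ) ^ (-((2 : ℕ) : ℤ)) := by
      rw [hpow2, e]
      refine (Padic.nonarchimedean _ _).trans (max_le hN ?_)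
      rw [norm_mul]
      calc ‖(n₁ : ℚ_[q]) - k‖ * ‖tr (σ + k • 1) + ((n₁ : ℚ_[q]) - k)‖ ≤ ((q : ℝ) ^ 2)⁻¹ * 1 :=
            mul_le_mul hn₁' htr1 (norm_nonneg _) (by positivity)
        _ = ((q : ℝ) ^ 2)⁻¹ := mul_one _
    rw [norm_add_intCast_smul_one ht hn, Padic.norm_int_le_pow_iff_dvd] at h
    exact h

/-- A `q`-adic number of norm `> 1` has norm `≥ q`. [folklore] -/
theorem le_norm_of_one_lt_norm {x : ℚ_[q]} (hx : 1 < ‖x‖) : (q : ℝ) ≤ ‖x‖ := by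
  have hx0 : x ≠ 0 := fun h => by rw [h, norm_zero] at hx; exact not_lt.mpr zero_le_one hx
  have hq1 : (1 : ℝ) < q := by exact_mod_cast hq.out.one_lt
  rw [Padic.norm_eq_zpow_neg_valuation hx0] at hx ⊢
  have h0 : 0 < -x.valuation := by
    by_contra h
    push Not at h
    exact not_lt.mpr (zpow_le_one_of_nonpos₀ hq1.le h) hx
  calc (q : ℝ) = (q : ℝ) ^ (1 : ℤ) := (zpow_one _).symm
    _ ≤ (q : ℝ) ^ (-x.valuation) := zpow_le_zpow_right₀ hq1.le (by omega)

/-- The norm of a sum is at most the larger norm, strict version: `‖y‖ < r`, `‖z‖ < r` give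
`‖y + z‖ < r`. [folklore] -/
theorem norm_add_lt_of_lt {y z : ℚ_[q]} {r : ℝ} (hy : ‖y‖ < r) (hz : ‖z‖ < r) : ‖y + z‖ < r :=
  lt_of_le_of_lt (Padic.nonarchimedean _ _) (max_lt hy hz)

/-- `tr (c • z) = c tr z`. [folklore] -/
theorem tr_smul (c : ℚ_[q]) (z : QuadraticAlgebra ℚ_[q] a b) : tr (c • z) = c * tr z := by
  simp [tr]; ring

/-- `N (c • z) = c² N z`. [folklore] -/
theorem norm_smul' (c : ℚ_[q]) (z : QuadraticAlgebra ℚ_[q] a b) : (c • z).norm = c ^ 2 * z.norm := by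
  simp [QuadraticAlgebra.norm_def]; ring

/-- Decomposition `z = α·1 + β·σ` along a generator `σ ∉ ℚ_q`. [folklore] -/
theorem exists_eq_smul_one_add_smul {σ : QuadraticAlgebra ℚ_[q] a b} (hσ : σ.im ≠ 0)
    (z : QuadraticAlgebra ℚ_[q] a b) : ∃ α β : ℚ_[q], z = α • 1 + β • σ := by
  refine ⟨z.re - z.im / σ.im * σ.re, z.im / σ.im, ?_⟩
  ext
  · simp [QuadraticAlgebra.re_one]
  · simp [QuadraticAlgebra.im_one, div_mul_cancel₀ _ hσ]

end Generic

/-! ### The hypotheses at a ramified prime -/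

section Ramified

variable {D : Type u} [Ring D] [Algebra ℚ D] [IsQuaternionAlgebra ℚ D] {p : ℕ} [hp : Fact p.Prime]
  {O : Submodule ℤ D} {γ : D} {B : Submodule ℤ D} {σ₀ : D} {r₀ : ℚ} {m : ℕ} {tB nB : ℤ}

/-- The quadratic `ℚ_p`-algebra `K_p = ℚ_p[X]/(X² - tX + n)` of `γ` (`t = trd γ`, `n = nrd γ`). -/
local notation "Kp" D ";" p ";" γ =>
  QuadraticAlgebra ℚ_[p] (-((reducedNorm ℚ D γ : ℚ) : ℚ_[p])) ((reducedTrace ℚ D γ : ℚ) : ℚ_[p])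

/-- The generator `σ_p = r₀ + ω/m` of `B_p = [1, σ_p]` (notation). -/
local notation "σp" => (QuadraticAlgebra.mk (r₀ : ℚ_[p]) (((m : ℚ)⁻¹ : ℚ) : ℚ_[p]) : Kp D ; p ; γ)

/-- The `p`-adic absolute value of the reduced norm, `|nrd x|_p`. [folklore] -/
def padicNrd (p : ℕ) [Fact p.Prime] (x : D) : ℝ := ‖((reducedNorm ℚ D x : ℚ) : ℚ_[p])‖

/-- `|nrd(x y)|_p = |nrd x|_p |nrd y|_p`. [folklore] -/
theorem padicNrd_mul (x y : D) : padicNrd p (x * y) = padicNrd p x * padicNrd p y := by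
  rw [padicNrd, padicNrd, padicNrd, reducedNorm_mul_holds ℚ D, Rat.cast_mul, norm_mul]

/-- `|nrd 1|_p = 1`. [folklore] -/
theorem padicNrd_one : padicNrd p (1 : D) = 1 := by
  rw [padicNrd, reducedNorm_one ℚ D, Rat.cast_one, norm_one]

/-- `|nrd x|_p ≠ 0` for a unit `x`. [folklore] -/
theorem padicNrd_units_ne_zero (x : Dˣ) : padicNrd p (x : D) ≠ 0 := by
  intro h
  have h1 : padicNrd p ((x : D) * (x⁻¹ : Dˣ)) = 1 := by rw [Units.mul_inv, padicNrd_one]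
  rw [padicNrd_mul, h, zero_mul] at h1
  exact zero_ne_one h1

/-- `|nrd x|_p > 0` for a unit `x`. [folklore] -/
theorem padicNrd_units_pos (x : Dˣ) : 0 < padicNrd p (x : D) :=
  lt_of_le_of_ne (norm_nonneg _) (padicNrd_units_ne_zero x).symm

/-- `|nrd|_p` as a homomorphism `Dˣ → ℝ`. [folklore] -/
def padicNrdHom (p : ℕ) [Fact p.Prime] : Dˣ →* ℝ where
  toFun x := padicNrd p (x : D)
  map_one' := by rw [Units.val_one, padicNrd_one]
  map_mul' x y := by rw [Units.val_mul, padicNrd_mul]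

/-- `|nrd (c ^ j)|_p = |nrd c|_p ^ j` for `j ∈ ℤ`. [folklore] -/
theorem padicNrd_units_zpow (c : Dˣ) (j : ℤ) : padicNrd p ((c ^ j : Dˣ) : D) = padicNrd p (c : D) ^ j :=
  map_zpow (padicNrdHom p) c j

/-- `|nrd x|_p ∈ p^ℤ` for a unit `x`. [folklore] -/
theorem exists_padicNrd_eq_zpow (x : Dˣ) : ∃ j : ℤ, padicNrd p (x : D) = (p : ℝ) ^ j := by
  have h0 : ((reducedNorm ℚ D (x : D) : ℚ) : ℚ_[p]) ≠ 0 := fun h => by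
    apply padicNrd_units_ne_zero (p := p) x
    rw [padicNrd, h, norm_zero]
  exact ⟨_, Padic.norm_eq_zpow_neg_valuation h0⟩

/-- `|nrd c|_p = p⁻²` for the scalar `c = p`. [folklore] -/
theorem padicNrd_natCast : padicNrd p (algebraMap ℚ D p) = ((p : ℝ) ^ 2)⁻¹ := by
  rw [padicNrd, reducedNorm_algebraMap]
  push_cast
  rw [norm_pow, Padic.norm_p, inv_pow]

/-! ### Reduced norm and trace of `r + sγ` read in `K_p` -/

/-- `nrd(r + sγ) = N(r + sω)` (cast into `ℚ_p`). [folklore] -/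
theorem ratCast_reducedNorm_ratCoords (r s : ℚ) :
    ((reducedNorm ℚ D (algebraMap ℚ D r + s • γ) : ℚ) : ℚ_[p]) =
      ((⟨(r : ℚ_[p]), (s : ℚ_[p])⟩ : Kp D ; p ; γ)).norm := by
  rw [reducedNorm_add, reducedNorm_algebraMap, reducedNorm_smul, standardInvolution_smul,
    mul_smul_comm, ← Algebra.smul_def, map_smul, map_smul, reducedTrace_standardInvolution,
    QuadraticAlgebra.norm_def]
  simp only [smul_eq_mul]
  push_cast
  ring

/-- `trd(r + sγ) = tr(r + sω)` (cast into `ℚ_p`). [folklore] -/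
theorem ratCast_reducedTrace_ratCoords (r s : ℚ) :
    ((reducedTrace ℚ D (algebraMap ℚ D r + s • γ) : ℚ) : ℚ_[p]) =
      tr ((⟨(r : ℚ_[p]), (s : ℚ_[p])⟩ : Kp D ; p ; γ)) := by
  rw [map_add, map_smul, reducedTrace_algebraMap_rat, tr, smul_eq_mul]
  push_cast
  ring

/-- `|nrd(r + sγ)|_p = ‖N(r + sω)‖`. [folklore] -/
theorem padicNrd_ratCoords (r s : ℚ) :
    padicNrd p (algebraMap ℚ D r + s • γ) = ‖((⟨(r : ℚ_[p]), (s : ℚ_[p])⟩ : Kp D ; p ; γ)).norm‖ := by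
  rw [padicNrd, ratCast_reducedNorm_ratCoords]

/-- **Hypotheses of the local count at a ramified prime `p`**, bundled: `ℚ_p ⊗ D` is a division
algebra, `O` is a `ℤ`-order maximal at `p` (`O_(p) = {nrd, trd ∈ ℤ_(p)}`), `γ ∉ ℚ`, and `B ∋ γ`
is an order of `ℚ(γ)` with `ℤ`-basis `(1, σ₀)`, `σ₀ = r₀ + γ/m`, `σ₀² = t_B σ₀ - n_B`. [cite: VignerasLNM800, Ch. II §1 Lemme 1.5, §3] -/
structure RamHyp (p : ℕ) [Fact p.Prime] (O : Submodule ℤ D) (γ : D) (B : Submodule ℤ D) (σ₀ : D)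
    (r₀ : ℚ) (m : ℕ) (tB nB : ℤ) : Prop where
  hdivp : ∀ X : ScalarExtension ℚ ℚ_[p] D, X ≠ 0 → IsUnit X
  hOZ : IsZOrder O
  hOp : ∀ x : D, x ∈ localAt p O ↔ ¬ p ∣ (reducedNorm ℚ D x).den ∧ ¬ p ∣ (reducedTrace ℚ D x).den
  hγ : γ ∉ (⊥ : Subalgebra ℚ D)
  hB : IsQuadOrder γ B
  hm : m ≠ 0
  hσ₀ : σ₀ = algebraMap ℚ D r₀ + (m : ℚ)⁻¹ • γ
  hBσ : ∀ b : D, b ∈ B ↔ ∃ u v : ℤ, b = algebraMap ℚ D u + v • σ₀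
  hsq : σ₀ * σ₀ = (tB : ℚ) • σ₀ - algebraMap ℚ D nB

namespace RamHyp

variable (H : RamHyp p O γ B σ₀ r₀ m tB nB)
include H

omit [IsQuaternionAlgebra ℚ D] in
/-- `σ_p ∉ ℚ_p`. [folklore] -/
theorem σp_im_ne : (σp).im ≠ 0 := by
  show (((m : ℚ)⁻¹ : ℚ) : ℚ_[p]) ≠ 0
  push_cast
  exact inv_ne_zero (Nat.cast_ne_zero.mpr H.hm)

omit [IsQuaternionAlgebra ℚ D] in
/-- `σ_p.im = 1/m`. [folklore] -/
theorem σp_im : (σp).im = ((m : ℚ_[p]))⁻¹ := by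
  have := H.hm
  show (((m : ℚ)⁻¹ : ℚ) : ℚ_[p]) = _
  push_cast
  rfl

/-- **`trd σ₀ = t_B` and `nrd σ₀ = n_B`** (compare `σ₀² = trd(σ₀) σ₀ - nrd(σ₀)` with
`σ₀² = t_B σ₀ - n_B`; `1, γ` are independent). [folklore] -/
theorem reducedTrace_σ₀_and_reducedNorm_σ₀ :
    reducedTrace ℚ D σ₀ = tB ∧ reducedNorm ℚ D σ₀ = nB := by
  have hmQ : (m : ℚ) ≠ 0 := Nat.cast_ne_zero.mpr H.hm
  have e : ∀ c d : ℚ, c • σ₀ - algebraMap ℚ D d =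
      algebraMap ℚ D (c * r₀ - d) + (c * (m : ℚ)⁻¹) • γ := by
    intro c d
    rw [H.hσ₀, smul_add, smul_smul, map_sub, map_mul, Algebra.smul_def c (algebraMap ℚ D r₀)]
    abel
  have h1 := mul_self_eq_reducedTrace_mul_sub_reducedNorm ℚ D σ₀
  rw [H.hsq, ← Algebra.smul_def, e, e] at h1
  obtain ⟨h2, h3⟩ := rat_coords_unique H.hγ h1
  have ht : reducedTrace ℚ D σ₀ = tB := by
    have := mul_right_cancel₀ (inv_ne_zero hmQ) h3
    exact this.symm
  refine ⟨ht, ?_⟩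
  rw [ht] at h2
  linarith

/-- `tr σ_p = t_B`. [folklore] -/
theorem tr_σp : tr σp = (tB : ℚ_[p]) := by
  rw [← ratCast_reducedTrace_ratCoords, ← H.hσ₀, H.reducedTrace_σ₀_and_reducedNorm_σ₀.1]
  push_cast
  rfl

/-- `N σ_p = n_B`. [folklore] -/
theorem norm_σp : (σp).norm = (nB : ℚ_[p]) := by
  rw [← ratCast_reducedNorm_ratCoords, ← H.hσ₀, H.reducedTrace_σ₀_and_reducedNorm_σ₀.2]
  push_cast
  rfl

/-- `[1, σ_p]` is a ring lattice. [folklore] -/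
theorem ring_σp : σp * σp ∈ latt 1 σp := by
  rw [mul_self_mem_latt_one_iff H.σp_im_ne, H.tr_σp, H.norm_σp]
  exact ⟨Padic.norm_int_le_one _, Padic.norm_int_le_one _⟩

/-- The norm of an element of `[1, σ_p]` is integral. [folklore] -/
theorem norm_norm_le_one_of_mem_latt {z : Kp D ; p ; γ} (hz : z ∈ latt 1 σp) : ‖z.norm‖ ≤ 1 := by
  obtain ⟨u, v, hu, hv, rfl⟩ := hz
  rw [norm_smul_one_add_smul, H.tr_σp, H.norm_σp]
  refine (Padic.nonarchimedean _ _).trans (max_le ((Padic.nonarchimedean _ _).trans (max_le ?_ ?_)) ?_)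
  · rw [norm_pow]; exact pow_le_one₀ (norm_nonneg _) hu
  · rw [norm_mul, norm_mul]
    exact mul_le_one₀ (mul_le_one₀ hu (norm_nonneg _) hv) (norm_nonneg _) (Padic.norm_int_le_one _)
  · rw [norm_mul, norm_pow]
    exact mul_le_one₀ (pow_le_one₀ (norm_nonneg _) hv) (norm_nonneg _) (Padic.norm_int_le_one _)

/-! ### Membership dictionary -/

/-- **`y ∈ O_(p) ↔ |nrd y|_p ≤ 1`** (the trace condition is automatic, Lemme 1.4). [cite: VignerasLNM800, Ch. II §1 Lemme 1.4–1.5] -/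
theorem mem_localAt_iff_padicNrd (y : D) : y ∈ localAt p O ↔ padicNrd p y ≤ 1 := by
  rw [H.hOp, padicNrd, Padic.norm_ratCast_le_one_iff]
  exact ⟨fun h => h.1, fun h => ⟨h, not_dvd_den_reducedTrace_of_not_dvd_den_reducedNorm H.hdivp h⟩⟩

/-- `r + sγ ∈ O_(p) ↔ ‖N(r + sω)‖ ≤ 1`. [folklore] -/
theorem ratCoords_mem_localAt_iff (r s : ℚ) :
    algebraMap ℚ D r + s • γ ∈ localAt p O ↔ ‖((⟨(r : ℚ_[p]), (s : ℚ_[p])⟩ : Kp D ; p ; γ)).norm‖ ≤ 1 := by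
  rw [H.mem_localAt_iff_padicNrd, padicNrd_ratCoords]

/-- **Lemme 1.4 in `K_p`**: `‖N(r + sω)‖ ≤ 1 → ‖tr(r + sω)‖ ≤ 1`. [cite: VignerasLNM800, Ch. II §1 Lemme 1.4] -/
theorem norm_tr_le_one (r s : ℚ) (h : ‖((⟨(r : ℚ_[p]), (s : ℚ_[p])⟩ : Kp D ; p ; γ)).norm‖ ≤ 1) :
    ‖tr ((⟨(r : ℚ_[p]), (s : ℚ_[p])⟩ : Kp D ; p ; γ))‖ ≤ 1 := by
  rw [← ratCast_reducedNorm_ratCoords, Padic.norm_ratCast_le_one_iff] at h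
  rw [← ratCast_reducedTrace_ratCoords, Padic.norm_ratCast_le_one_iff]
  exact not_dvd_den_reducedTrace_of_not_dvd_den_reducedNorm H.hdivp h

/-- **The rational points of `[1, σ_p]` are `B_(p)`**: `r + sω ∈ [1, σ_p] ↔ r + sγ ∈ B_(p)`. [folklore] -/
theorem ratCoords_mem_latt_one_iff (r s : ℚ) :
    (⟨(r : ℚ_[p]), (s : ℚ_[p])⟩ : Kp D ; p ; γ) ∈ latt 1 σp ↔ algebraMap ℚ D r + s • γ ∈ localAt p B := by
  have hcop : ∀ w : ℚ, w.den.Coprime p ↔ ‖(w : ℚ_[p])‖ ≤ 1 := fun w => by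
    rw [Padic.norm_ratCast_le_one_iff, Nat.coprime_comm, Nat.Prime.coprime_iff_not_dvd hp.out]
  have hmq : (m : ℚ_[p]) ≠ 0 := Nat.cast_ne_zero.mpr H.hm
  have hmQ : (m : ℚ) ≠ 0 := Nat.cast_ne_zero.mpr H.hm
  rw [IsQuadOrder.mem_localAt_iff_of_monogenic H.hBσ]
  constructor
  · rintro ⟨u, w, hu, hw, huw⟩
    have hre := congrArg QuadraticAlgebra.re huw
    have him := congrArg QuadraticAlgebra.im huw
    simp only [QuadraticAlgebra.re_add, QuadraticAlgebra.im_add, QuadraticAlgebra.re_smul,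
      QuadraticAlgebra.im_smul, smul_eq_mul] at hre him
    change (r : ℚ_[p]) = u * 1 + w * r₀ at hre
    change (s : ℚ_[p]) = u * 0 + w * (((m : ℚ)⁻¹ : ℚ) : ℚ_[p]) at him
    rw [show ((((m : ℚ)⁻¹ : ℚ)) : ℚ_[p]) = ((m : ℚ_[p]))⁻¹ from H.σp_im] at him
    have hw' : w = ((s * m : ℚ) : ℚ_[p]) := by
      push_cast; rw [him]; field_simp; ring
    have hu' : u = ((r - s * m * r₀ : ℚ) : ℚ_[p]) := by
      push_cast; rw [hre, hw']; push_cast; ring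
    refine ⟨r - s * m * r₀, s * m, ?_, ?_, ?_⟩
    · rw [hcop, ← hu']; exact hu
    · rw [hcop, ← hw']; exact hw
    · rw [H.hσ₀, ratCoords_monogenic]
      congr 2
      · ring
      · field_simp
  · rintro ⟨u, v, hu, hv, huv⟩
    have e := (huv.trans (H.hσ₀ ▸ ratCoords_monogenic γ r₀ m u v))
    obtain ⟨h1, h2⟩ := rat_coords_unique H.hγ e
    refine ⟨u, v, (hcop u).mp hu, (hcop v).mp hv, ?_⟩
    ext
    · simp [QuadraticAlgebra.re_one, h1]
    · rw [show ((⟨(r : ℚ_[p]), (s : ℚ_[p])⟩ : Kp D ; p ; γ)).im = (s : ℚ_[p]) from rfl]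
      simp only [QuadraticAlgebra.im_add, QuadraticAlgebra.im_smul, QuadraticAlgebra.im_one, smul_eq_mul,
        mul_zero, zero_add, h2]
      push_cast
      rfl

/-! ### The local ideals `x O_(p)` and their optimal orders -/

/-- **`y ∈ x O_(p) ↔ |nrd y|_p ≤ |nrd x|_p`.** [cite: VignerasLNM800, Ch. II §1 Lemme 1.5] -/
theorem mem_smul_localAt_iff (x : Dˣ) (y : D) : y ∈ x • localAt p O ↔ padicNrd p y ≤ padicNrd p (x : D) := by
  rw [mem_units_smul_submodule_iff, Units.smul_def, smul_eq_mul, H.mem_localAt_iff_padicNrd, padicNrd_mul]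
  have hx := padicNrd_units_pos (p := p) x
  have hinv : padicNrd p ((x⁻¹ : Dˣ) : D) = (padicNrd p (x : D))⁻¹ :=
    eq_inv_of_mul_eq_one_left (by rw [← padicNrd_mul, Units.inv_mul, padicNrd_one])
  rw [hinv, inv_mul_le_iff₀ hx, mul_one]

/-- `x ∈ x O_(p)`. [folklore] -/
theorem self_mem_smul_localAt (x : Dˣ) : (x : D) ∈ x • localAt p O :=
  (H.mem_smul_localAt_iff x x).mpr le_rfl

/-- **`x O_(p) = x' O_(p) ↔ |nrd x|_p = |nrd x'|_p`.** [cite: VignerasLNM800, Ch. II §1 Lemme 1.5] -/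
theorem smul_localAt_eq_iff (x x' : Dˣ) :
    x • localAt p O = x' • localAt p O ↔ padicNrd p (x : D) = padicNrd p (x' : D) := by
  constructor
  · intro h
    apply le_antisymm
    · have := H.self_mem_smul_localAt x; rw [h] at this; exact (H.mem_smul_localAt_iff x' x).mp this
    · have := H.self_mem_smul_localAt x'; rw [← h] at this; exact (H.mem_smul_localAt_iff x x').mp this
  · intro h
    ext y
    rw [H.mem_smul_localAt_iff, H.mem_smul_localAt_iff, h]

/-- **The left order of every `x O_(p)` is `O_(p)`** (`O_(p)` is the unique maximal order of
`D` at `p`). [cite: VignerasLNM800, Ch. II §1 Lemme 1.5] -/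
theorem leftOrder_smul_localAt (x : Dˣ) : leftOrder (x • localAt p O) = localAt p O := by
  ext h
  rw [mem_leftOrder_iff, H.mem_localAt_iff_padicNrd]
  constructor
  · intro hh
    have := (H.mem_smul_localAt_iff x _).mp (hh _ (H.self_mem_smul_localAt x))
    rw [padicNrd_mul] at this
    have hx := padicNrd_units_pos (p := p) x
    nlinarith [hx, this]
  · intro hh y hy
    rw [H.mem_smul_localAt_iff] at hy ⊢
    rw [padicNrd_mul]
    calc padicNrd p h * padicNrd p y ≤ 1 * padicNrd p y :=
          mul_le_mul_of_nonneg_right hh (norm_nonneg _)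
      _ ≤ padicNrd p (x : D) := by rw [one_mul]; exact hy

/-- **`x O_(p)` is a local ideal with optimal order `B_(p)` iff `B_(p) = O_(p) ∩ ℚ(γ)`**
(independently of `x`). [cite: VignerasLNM800, Ch. II §3] -/
theorem smul_localAt_mem_localIdeals_iff (x : Dˣ) :
    x • localAt p O ∈ localIdeals O γ B p ↔ localAt p O ⊓ adjoinLattice γ = localAt p B := by
  rw [mem_localIdeals_iff, optimalOrder, H.leftOrder_smul_localAt]
  exact ⟨fun h => h.2, fun h => ⟨⟨x, rfl⟩, h⟩⟩

/-- Every local ideal is `x O_(p)` and `B_(p) = O_(p) ∩ ℚ(γ)`. [folklore] -/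
theorem eq_of_mem_localIdeals {L : Submodule ℤ D} (hL : L ∈ localIdeals O γ B p) :
    localAt p O ⊓ adjoinLattice γ = localAt p B := by
  obtain ⟨⟨x, rfl⟩, hopt⟩ := hL
  exact (H.smul_localAt_mem_localIdeals_iff x).mp ⟨⟨x, rfl⟩, hopt⟩

/-! ### The count when `B_(p)` is, or is not, `O_(p) ∩ ℚ(γ)` -/

/-- **`m_p(B) = 0` if `B_(p) ≠ O_(p) ∩ ℚ(γ)`.** [cite: VignerasLNM800, Ch. II §3] -/
theorem localEmbeddingNumber_eq_zero (h : localAt p O ⊓ adjoinLattice γ ≠ localAt p B) :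
    localEmbeddingNumber O γ B p = 0 := by
  haveI : IsEmpty (LocalClass O γ B p) := ⟨fun C => by
    obtain ⟨L, -⟩ := LocalClass.mk_surjective C
    exact h (H.eq_of_mem_localIdeals L.2)⟩
  exact Nat.card_of_isEmpty

/-- **A uniformiser**: `u ∈ Dˣ` with `|nrd u|_p = p⁻¹`. [cite: VignerasLNM800, Ch. II §1 Cor. 1.7] -/
theorem exists_padicNrd_eq_inv : ∃ u : Dˣ, padicNrd p (u : D) = (p : ℝ)⁻¹ := by
  obtain ⟨u, hu, hup⟩ := exists_uniformiser H.hdivp H.hOZ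
  obtain ⟨n, hn, hpn⟩ := exists_reducedNorm_uniformiser H.hdivp H.hOp H.hOZ hu hup
  refine ⟨u, ?_⟩
  have hn1 : ‖(n : ℚ_[p])‖ = 1 := by
    refine le_antisymm (Padic.norm_int_le_one _) ?_
    by_contra hlt
    push Not at hlt
    exact hpn (Padic.norm_intCast_lt_one_iff.mp hlt)
  rw [padicNrd, hn]
  push_cast
  rw [norm_mul, Padic.norm_p, hn1, mul_one]

/-- A unit `π = p` of `D`. [folklore] -/
theorem isUnit_natCast : IsUnit (algebraMap ℚ D p) := by
  haveI : Nontrivial D := nontrivial_of_isQuaternionAlgebra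
  refine (forall_isUnit_of_padic_division H.hdivp) _ fun h0 => hp.out.ne_zero ?_
  exact_mod_cast (algebraMap ℚ D).injective (h0.trans (map_zero _).symm)

/-- **`m_p(B) = 1` if `B_(p) = O_(p) ∩ ℚ(γ)` and some `c ∈ ℚ(γ)ˣ` has `|N c|_p = p⁻¹`**
(`p` ramified in `ℚ(γ)`): all local ideals `x O_(p)`, `|nrd x|_p = p^{-j}`, are `c^j O_(p)`. [cite: VignerasLNM800, Ch. II §3; Ch. III §5 Cor. 5.12] -/
theorem localEmbeddingNumber_eq_one (hmax : localAt p O ⊓ adjoinLattice γ = localAt p B)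
    (hodd : ∃ c : Dˣ, (c : D) * γ = γ * c ∧ padicNrd p (c : D) = (p : ℝ)⁻¹) :
    localEmbeddingNumber O γ B p = 1 := by
  obtain ⟨c, hc, hcn⟩ := hodd
  have hp0 : (p : ℝ) ≠ 0 := by exact_mod_cast hp.out.ne_zero
  have hmem : ∀ x : Dˣ, x • localAt p O ∈ localIdeals O γ B p := fun x =>
    (H.smul_localAt_mem_localIdeals_iff x).mpr hmax
  rw [localEmbeddingNumber, Nat.card_eq_one_iff_unique]
  refine ⟨⟨fun C C' => ?_⟩, ⟨LocalClass.mk ⟨_, hmem 1⟩⟩⟩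
  obtain ⟨⟨L, ⟨x, rfl⟩, hx⟩, rfl⟩ := LocalClass.mk_surjective C
  obtain ⟨⟨L', ⟨x', rfl⟩, hx'⟩, rfl⟩ := LocalClass.mk_surjective C'
  rw [LocalClass.mk_eq_mk_iff]
  obtain ⟨j, hj⟩ := exists_padicNrd_eq_zpow (p := p) x
  obtain ⟨j', hj'⟩ := exists_padicNrd_eq_zpow (p := p) x'
  refine ⟨c ^ (j - j'), (Commute.units_zpow_right (Commute.symm hc) (j - j')).symm, ?_⟩
  change x' • localAt p O = (c ^ (j - j')) • (x • localAt p O)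
  rw [← mul_smul, eq_comm, H.smul_localAt_eq_iff, Units.val_mul, padicNrd_mul, padicNrd_units_zpow,
    hcn, hj, hj', inv_zpow', neg_sub, ← zpow_add₀ hp0]
  congr 1
  ring

/-- **`m_p(B) = 2` if `B_(p) = O_(p) ∩ ℚ(γ)` and no `c ∈ ℚ(γ)ˣ` has `|N c|_p = p⁻¹`**
(`p` inert in `ℚ(γ)`): the classes of `O_(p)` and `u O_(p)`, `u` a uniformiser. [cite: VignerasLNM800, Ch. II §3; Ch. III §5 Cor. 5.12] -/
theorem localEmbeddingNumber_eq_two (hmax : localAt p O ⊓ adjoinLattice γ = localAt p B)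
    (heven : ¬ ∃ c : Dˣ, (c : D) * γ = γ * c ∧ padicNrd p (c : D) = (p : ℝ)⁻¹) :
    localEmbeddingNumber O γ B p = 2 := by
  have hp0 : (p : ℝ) ≠ 0 := by exact_mod_cast hp.out.ne_zero
  have hmem : ∀ x : Dˣ, x • localAt p O ∈ localIdeals O γ B p := fun x =>
    (H.smul_localAt_mem_localIdeals_iff x).mpr hmax
  obtain ⟨u, hu⟩ := H.exists_padicNrd_eq_inv
  set π : Dˣ := H.isUnit_natCast.unit with hπdef
  have hπ : (π : D) = algebraMap ℚ D p := H.isUnit_natCast.unit_spec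
  have hπγ : ∀ i : ℤ, ((π ^ i : Dˣ) : D) * γ = γ * (π ^ i : Dˣ) := fun i =>
    (Commute.units_zpow_right (by rw [Commute, SemiconjBy, hπ]; exact (Algebra.commutes _ _).symm) i).symm
  have hπn : ∀ i : ℤ, padicNrd p ((π ^ i : Dˣ) : D) = (p : ℝ) ^ (-(2 * i)) := fun i => by
    rw [padicNrd_units_zpow, hπ, padicNrd_natCast, inv_zpow', ← zpow_natCast, ← zpow_mul]
    norm_num
  rw [localEmbeddingNumber, Nat.card_eq_two_iff]
  refine ⟨LocalClass.mk ⟨_, hmem 1⟩, LocalClass.mk ⟨_, hmem u⟩, ?_, ?_⟩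
  · intro h
    rw [LocalClass.mk_eq_mk_iff] at h
    obtain ⟨c, hc, hcu⟩ := h
    apply heven
    refine ⟨c, hc, ?_⟩
    change u • localAt p O = c • ((1 : Dˣ) • localAt p O) at hcu
    rw [one_smul, H.smul_localAt_eq_iff] at hcu
    rw [← hcu, hu]
  · rw [Set.eq_univ_iff_forall]
    intro C
    obtain ⟨⟨L, ⟨x, rfl⟩, hx⟩, rfl⟩ := LocalClass.mk_surjective C
    obtain ⟨j, hj⟩ := exists_padicNrd_eq_zpow (p := p) x
    rcases Int.even_or_odd' j with ⟨i, rfl | rfl⟩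
    · -- `|nrd x| = p^{2i}`: the class of `O_(p)`, `O_(p) = π^i x O_(p)`
      refine Set.mem_insert_iff.mpr (Or.inl ?_)
      rw [LocalClass.mk_eq_mk_iff]
      refine ⟨π ^ i, hπγ i, ?_⟩
      change (1 : Dˣ) • localAt p O = (π ^ i) • (x • localAt p O)
      rw [← mul_smul, H.smul_localAt_eq_iff, Units.val_one, padicNrd_one, Units.val_mul, padicNrd_mul, hj,
        hπn, ← zpow_add₀ hp0, neg_add_cancel, zpow_zero]
    · -- `|nrd x| = p^{2i+1}`: the class of `u O_(p)`, `u O_(p) = π^{i+1} x O_(p)`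
      refine Set.mem_insert_iff.mpr (Or.inr (Set.mem_singleton_iff.mpr ?_))
      rw [LocalClass.mk_eq_mk_iff]
      refine ⟨π ^ (i + 1), hπγ (i + 1), ?_⟩
      change u • localAt p O = (π ^ (i + 1)) • (x • localAt p O)
      rw [← mul_smul, H.smul_localAt_eq_iff, Units.val_mul, padicNrd_mul, hj, hπn, hu, ← zpow_neg_one,
        ← zpow_add₀ hp0]
      congr 1; ring

/-! ### `B_(p) = O_(p) ∩ ℚ(γ)` in coordinates -/

/-- `B_(p) = O_(p) ∩ ℚ(γ)` iff every `r + sω` of integral norm lies in `[1, σ_p]`. [folklore] -/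
theorem inf_adjoinLattice_eq_iff_forall :
    localAt p O ⊓ adjoinLattice γ = localAt p B ↔
      ∀ r s : ℚ, ‖((⟨(r : ℚ_[p]), (s : ℚ_[p])⟩ : Kp D ; p ; γ)).norm‖ ≤ 1 →
        (⟨(r : ℚ_[p]), (s : ℚ_[p])⟩ : Kp D ; p ; γ) ∈ latt 1 σp := by
  constructor
  · intro h r s hrs
    rw [H.ratCoords_mem_latt_one_iff, ← h]
    exact ⟨(H.ratCoords_mem_localAt_iff r s).mpr hrs, ratCoords_mem_adjoin γ r s⟩
  · intro h
    ext y
    constructor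
    · rintro ⟨hyO, hyγ⟩
      obtain ⟨r, s, rfl⟩ := exists_rat_eq_of_mem_adjoin (forall_isUnit_of_padic_division H.hdivp) H.hγ hyγ
      exact (H.ratCoords_mem_latt_one_iff r s).mp (h r s ((H.ratCoords_mem_localAt_iff r s).mp hyO))
    · intro hy
      obtain ⟨r, s, rfl⟩ := exists_rat_eq_of_mem_adjoin (forall_isUnit_of_padic_division H.hdivp) H.hγ (H.hB.localAt_le_adjoin p hy)
      exact ⟨(H.ratCoords_mem_localAt_iff r s).mpr
        (H.norm_norm_le_one_of_mem_latt ((H.ratCoords_mem_latt_one_iff r s).mpr hy)), ratCoords_mem_adjoin γ r s⟩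

omit [IsQuaternionAlgebra ℚ D] in
/-- The element `(σ₀ + k)/p` read in `K_p`: `p⁻¹(σ_p + k)`. [folklore] -/
theorem mk_div_eq (k : ℤ) :
    (⟨(((r₀ + k) / p : ℚ) : ℚ_[p]), ((((m : ℚ)⁻¹ / p : ℚ)) : ℚ_[p])⟩ : Kp D ; p ; γ) =
      (p : ℚ_[p])⁻¹ • (σp + (k : ℚ_[p]) • 1) := by
  have hp0 : (p : ℚ_[p]) ≠ 0 := Nat.cast_ne_zero.mpr hp.out.ne_zero
  have := H.hm
  ext
  · simp only [QuadraticAlgebra.re_smul, QuadraticAlgebra.re_add, QuadraticAlgebra.re_one, smul_eq_mul]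
    push_cast
    field_simp
  · simp only [QuadraticAlgebra.im_smul, QuadraticAlgebra.im_add, QuadraticAlgebra.im_one, smul_eq_mul,
      mul_zero, add_zero]
    push_cast
    field_simp

omit [IsQuaternionAlgebra ℚ D] in
/-- The element `σ₀ + k` read in `K_p`: `σ_p + k`. [folklore] -/
theorem mk_add_eq (k : ℤ) :
    (⟨(((r₀ + k : ℚ)) : ℚ_[p]), ((((m : ℚ)⁻¹ : ℚ)) : ℚ_[p])⟩ : Kp D ; p ; γ) = σp + (k : ℚ_[p]) • 1 := by
  have := H.hm
  ext
  · simp only [QuadraticAlgebra.re_add, QuadraticAlgebra.re_smul, QuadraticAlgebra.re_one, smul_eq_mul]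
    push_cast
    ring
  · simp only [QuadraticAlgebra.im_add, QuadraticAlgebra.im_smul, QuadraticAlgebra.im_one, smul_eq_mul]
    ring

/-- `|nrd(σ₀ + k)|_p = |k² + t_B k + n_B|_p`. [folklore] -/
theorem padicNrd_σ₀_add (k : ℤ) :
    padicNrd p (algebraMap ℚ D (r₀ + k) + ((m : ℚ)⁻¹) • γ) = ‖((k ^ 2 + tB * k + nB : ℤ) : ℚ_[p])‖ := by
  rw [padicNrd_ratCoords, H.mk_add_eq, norm_add_intCast_smul_one H.tr_σp H.norm_σp]

/-- **`B_(p) = O_(p) ∩ ℚ(γ) ↔ ¬ ∃ k, p ∣ t_B + 2k ∧ p² ∣ k² + t_B k + n_B`** (`B` is `p`-maximal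
iff no `(σ₀ + k)/p` is integral). [cite: VignerasLNM800, Ch. II §3] -/
theorem forall_mem_latt_iff_not_nonmax :
    (∀ r s : ℚ, ‖((⟨(r : ℚ_[p]), (s : ℚ_[p])⟩ : Kp D ; p ; γ)).norm‖ ≤ 1 →
        (⟨(r : ℚ_[p]), (s : ℚ_[p])⟩ : Kp D ; p ; γ) ∈ latt 1 σp) ↔
      ¬ ∃ k : ℤ, (p : ℤ) ∣ tB + 2 * k ∧ (p : ℤ) ^ 2 ∣ k ^ 2 + tB * k + nB := by
  have hp0 : (p : ℚ_[p]) ≠ 0 := Nat.cast_ne_zero.mpr hp.out.ne_zero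
  have hpr : (0 : ℝ) < p := by exact_mod_cast hp.out.pos
  have hp1 : (1 : ℝ) < p := by exact_mod_cast hp.out.one_lt
  constructor
  · rintro h ⟨k, -, h2⟩
    have hmem := h ((r₀ + k) / p) ((m : ℚ)⁻¹ / p) ?_
    · rw [H.mk_div_eq] at hmem
      obtain ⟨u, v, -, hv, huv⟩ := hmem
      rw [smul_add, smul_smul, add_comm] at huv
      obtain ⟨-, h2'⟩ := smul_one_add_smul_inj H.σp_im_ne huv
      rw [← h2', norm_inv, Padic.norm_p, inv_inv] at hv
      exact not_lt.mpr hv hp1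
    · rw [H.mk_div_eq, norm_smul', norm_add_intCast_smul_one H.tr_σp H.norm_σp, norm_mul, norm_pow,
        norm_inv, Padic.norm_p, inv_inv]
      obtain ⟨c, hc⟩ := h2
      rw [hc]
      push_cast
      rw [norm_mul, norm_pow, Padic.norm_p, ← mul_assoc, inv_pow, mul_inv_cancel₀ (pow_ne_zero 2 hpr.ne'),
        one_mul]
      exact Padic.norm_int_le_one c
  · intro hnm r s hN
    obtain ⟨α, β, hαβ⟩ := exists_eq_smul_one_add_smul H.σp_im_ne
      ((⟨(r : ℚ_[p]), (s : ℚ_[p])⟩ : Kp D ; p ; γ))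
    by_cases hle : ‖α‖ ≤ 1 ∧ ‖β‖ ≤ 1
    · exact ⟨α, β, hle.1, hle.2, hαβ⟩
    exfalso
    have hT := H.norm_tr_le_one r s hN
    rw [hαβ] at hN hT
    rcases le_or_gt ‖α‖ ‖β‖ with hab | hab
    · -- `‖β‖ > 1`: `σ_p + α/β` is too integral
      have hβ1 : 1 < ‖β‖ := by
        by_contra hβ
        push Not at hβ
        exact hle ⟨hab.trans hβ, hβ⟩
      have hβ0 : β ≠ 0 := fun h0 => by rw [h0, norm_zero] at hβ1; exact not_lt.mpr zero_le_one hβ1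
      have hβpos : 0 < ‖β‖ := norm_pos_iff.mpr hβ0
      have hβp : (p : ℝ) ≤ ‖β‖ := le_norm_of_one_lt_norm hβ1
      have hc1 : ‖α / β‖ ≤ 1 := by rw [norm_div]; exact div_le_one_of_le₀ hab (norm_nonneg _)
      have e : α • (1 : Kp D ; p ; γ) + β • σp = β • (σp + (α / β) • 1) := by
        rw [smul_add, smul_smul, mul_div_cancel₀ _ hβ0, add_comm]
      rw [e, norm_smul', norm_mul, norm_pow] at hN
      rw [e, tr_smul, norm_mul] at hT
      have hN' : ‖(σp + (α / β) • 1).norm‖ ≤ ((p : ℝ) ^ 2)⁻¹ := by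
        have hX : ‖(σp + (α / β) • 1).norm‖ ≤ (‖β‖ ^ 2)⁻¹ := by
          have := (le_div_iff₀' (pow_pos hβpos 2)).mpr hN; rwa [one_div] at this
        exact hX.trans (inv_anti₀ (pow_pos hpr 2) (pow_le_pow_left₀ hpr.le hβp 2))
      have hT' : ‖tr (σp + (α / β) • 1)‖ ≤ (p : ℝ)⁻¹ := by
        have hX : ‖tr (σp + (α / β) • 1)‖ ≤ ‖β‖⁻¹ := by
          have := (le_div_iff₀' hβpos).mpr hT; rwa [one_div] at this
        exact hX.trans (inv_anti₀ hpr hβp)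
      obtain ⟨k₁, hk₁⟩ := exists_int_nonmax_of_padic H.tr_σp H.norm_σp hc1 hT' hN'
      exact hnm ⟨k₁, hk₁⟩
    · -- `‖α‖ > ‖β‖`, `‖α‖ > 1`: the norm `α² + αβt + β²n` is not integral
      have hα1 : 1 < ‖α‖ := by
        by_contra hα
        push Not at hα
        exact hle ⟨hα, hab.le.trans hα⟩
      have hα0 : 0 < ‖α‖ := lt_trans zero_lt_one hα1
      rw [norm_smul_one_add_smul, H.tr_σp, H.norm_σp] at hN
      have h1 : ‖α * β * (tB : ℚ_[p])‖ < ‖α‖ ^ 2 := by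
        rw [norm_mul, norm_mul, sq]
        calc ‖α‖ * ‖β‖ * ‖(tB : ℚ_[p])‖ ≤ ‖α‖ * ‖β‖ * 1 := by
              gcongr; exact Padic.norm_int_le_one _
          _ < ‖α‖ * ‖α‖ := by rw [mul_one]; gcongr
      have h2 : ‖β ^ 2 * (nB : ℚ_[p])‖ < ‖α‖ ^ 2 := by
        rw [norm_mul, norm_pow]
        calc ‖β‖ ^ 2 * ‖(nB : ℚ_[p])‖ ≤ ‖β‖ ^ 2 * 1 := by
              gcongr; exact Padic.norm_int_le_one _
          _ < ‖α‖ ^ 2 := by rw [mul_one]; gcongr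
      have h3 : ‖α ^ 2‖ < ‖α‖ ^ 2 := by
        have e : α ^ 2 = (α ^ 2 + α * β * (tB : ℚ_[p]) + β ^ 2 * (nB : ℚ_[p])) -
            (α * β * (tB : ℚ_[p]) + β ^ 2 * (nB : ℚ_[p])) := by ring
        rw [e]
        refine lt_of_le_of_lt (norm_sub_le_max _ _) (max_lt (lt_of_le_of_lt hN ?_) (norm_add_lt_of_lt h1 h2))
        exact one_lt_pow₀ hα1 two_ne_zero
      rw [norm_pow] at h3
      exact lt_irrefl _ h3

/-- **`B_(p) = O_(p) ∩ ℚ(γ)` in integer form.** [cite: VignerasLNM800, Ch. II §3] -/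
theorem inf_adjoinLattice_eq_iff :
    localAt p O ⊓ adjoinLattice γ = localAt p B ↔
      ¬ ∃ k : ℤ, (p : ℤ) ∣ tB + 2 * k ∧ (p : ℤ) ^ 2 ∣ k ^ 2 + tB * k + nB := by
  rw [H.inf_adjoinLattice_eq_iff_forall, H.forall_mem_latt_iff_not_nonmax]

/-! ### At a ramified prime, `p ∣ N(σ₀ + k)` forces `p ∣ tr(σ₀ + k)` -/

/-- **Lemme 1.4 for `σ₀ + k`**: `p ∣ k² + t_B k + n_B → p ∣ t_B + 2k` (apply "integral norm ⇒
integral trace" to `(σ₀ + k)²/p`, whose trace is `(tr² - 2N)/p`). In particular `x² - t_B x + n_B`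
has at most one root mod `p`: `p` does not split in `ℚ(γ) ⊆ D_p`. [cite: VignerasLNM800, Ch. II §1 Lemme 1.4] -/
theorem dvd_tr_of_dvd_norm (k : ℤ) (hk : (p : ℤ) ∣ k ^ 2 + tB * k + nB) : (p : ℤ) ∣ tB + 2 * k := by
  have hpr : (0 : ℝ) < p := by exact_mod_cast hp.out.pos
  set y : D := algebraMap ℚ D (r₀ + k) + ((m : ℚ)⁻¹) • γ with hy
  have hN : ((reducedNorm ℚ D y : ℚ) : ℚ_[p]) = ((k ^ 2 + tB * k + nB : ℤ) : ℚ_[p]) := by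
    rw [hy, ratCast_reducedNorm_ratCoords, H.mk_add_eq, norm_add_intCast_smul_one H.tr_σp H.norm_σp]
  have hT : ((reducedTrace ℚ D y : ℚ) : ℚ_[p]) = ((tB + 2 * k : ℤ) : ℚ_[p]) := by
    rw [hy, ratCast_reducedTrace_ratCoords, H.mk_add_eq, tr_add_intCast_smul_one H.tr_σp]
  have hNle : ‖((k ^ 2 + tB * k + nB : ℤ) : ℚ_[p])‖ ≤ (p : ℝ)⁻¹ := by
    have h := (Padic.norm_int_le_pow_iff_dvd (k ^ 2 + tB * k + nB) 1).mpr (by rw [pow_one]; exact hk)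
    rwa [show (-((1 : ℕ) : ℤ)) = -1 by norm_num, zpow_neg_one] at h
  have hNlt : ‖((k ^ 2 + tB * k + nB : ℤ) : ℚ_[p])‖ < 1 :=
    lt_of_le_of_lt hNle (inv_lt_one_of_one_lt₀ (by exact_mod_cast hp.out.one_lt))
  -- `w = (σ₀ + k)²/p` has integral norm
  have hw : ¬ p ∣ (reducedNorm ℚ D ((p : ℚ)⁻¹ • (y * y))).den := by
    rw [← Padic.norm_ratCast_le_one_iff, reducedNorm_smul, reducedNorm_mul_holds ℚ D]
    push_cast
    rw [hN, norm_mul, norm_pow, norm_inv, Padic.norm_p, inv_inv, norm_mul]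
    calc (p : ℝ) ^ 2 * (‖((k ^ 2 + tB * k + nB : ℤ) : ℚ_[p])‖ * ‖((k ^ 2 + tB * k + nB : ℤ) : ℚ_[p])‖) ≤
        (p : ℝ) ^ 2 * ((p : ℝ)⁻¹ * (p : ℝ)⁻¹) := by gcongr
      _ = 1 := by field_simp
  -- hence integral trace `(tr² - 2N)/p`
  have htw := not_dvd_den_reducedTrace_of_not_dvd_den_reducedNorm H.hdivp hw
  rw [← Padic.norm_ratCast_le_one_iff, map_smul, mul_self_eq_reducedTrace_mul_sub_reducedNorm ℚ D y,
    map_sub, ← Algebra.smul_def, map_smul, reducedTrace_algebraMap_rat, smul_eq_mul, smul_eq_mul] at htw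
  push_cast at htw
  rw [hN, hT, norm_mul, norm_inv, Padic.norm_p, inv_inv] at htw
  set T : ℚ_[p] := ((tB + 2 * k : ℤ) : ℚ_[p]) with hTdef
  set N : ℚ_[p] := ((k ^ 2 + tB * k + nB : ℤ) : ℚ_[p]) with hNdef
  have hsub : ‖T * T - 2 * N‖ < 1 := by
    have h1 : ‖T * T - 2 * N‖ ≤ (p : ℝ)⁻¹ := by
      have := (le_div_iff₀' hpr).mpr htw; rwa [one_div] at this
    exact lt_of_le_of_lt h1 (inv_lt_one_of_one_lt₀ (by exact_mod_cast hp.out.one_lt))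
  have h2N : ‖2 * N‖ < 1 := by
    rw [norm_mul]; exact mul_lt_one_of_nonneg_of_lt_one_right norm_two_le_one (norm_nonneg _) hNlt
  have hTT : ‖T * T‖ < 1 := by
    have e : T * T = (T * T - 2 * N) + 2 * N := by ring
    rw [e]; exact norm_add_lt_of_lt hsub h2N
  have hT1 : ‖T‖ < 1 := by
    by_contra h
    push Not at h
    rw [norm_mul] at hTT
    have := mul_le_mul h h zero_le_one (norm_nonneg _)
    rw [one_mul] at this
    exact not_lt.mpr this hTT
  exact Padic.norm_intCast_lt_one_iff.mp hT1

/-- **At most one root of `x² + t_B x + n_B` mod `p`.** [cite: VignerasLNM800, Ch. II §1 Lemme 1.4] -/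
theorem card_roots_le_one :
    ((Finset.range p).filter (fun k : ℕ => (p : ℤ) ∣ (k : ℤ) ^ 2 + tB * k + nB)).card ≤ 1 := by
  refine Finset.card_le_one.mpr fun a ha b hb => ?_
  rw [Finset.mem_filter, Finset.mem_range] at ha hb
  have htb := H.dvd_tr_of_dvd_norm b hb.2
  have h : (p : ℤ) ∣ ((a : ℤ) - b) ^ 2 := by
    have e : ((a : ℤ) - b) ^ 2 =
        ((a : ℤ) ^ 2 + tB * a + nB) - ((b : ℤ) ^ 2 + tB * b + nB) - ((a : ℤ) - b) * (tB + 2 * b) := by ring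
    rw [e]
    exact dvd_sub (dvd_sub ha.2 hb.2) (dvd_mul_of_dvd_right htb _)
  have hab : (p : ℤ) ∣ (a : ℤ) - b := (Nat.prime_iff_prime_int.mp hp.out).dvd_of_dvd_pow h
  exact ((Nat.modEq_iff_dvd.mpr hab).eq_of_lt_of_lt hb.1 ha.1).symm

/-! ### `p` ramified in `ℚ(γ)` in integer form -/

/-- **Some `c ∈ ℚ(γ)ˣ` has `|N c|_p = p⁻¹` iff `x² + t_B x + n_B` has a root mod `p`**, given
`B_(p) = O_(p) ∩ ℚ(γ)`. [cite: VignerasLNM800, Ch. II §3] -/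
theorem exists_padicNrd_eq_inv_iff
    (hmax : ∀ r s : ℚ, ‖((⟨(r : ℚ_[p]), (s : ℚ_[p])⟩ : Kp D ; p ; γ)).norm‖ ≤ 1 →
      (⟨(r : ℚ_[p]), (s : ℚ_[p])⟩ : Kp D ; p ; γ) ∈ latt 1 σp) :
    (∃ c : Dˣ, (c : D) * γ = γ * c ∧ padicNrd p (c : D) = (p : ℝ)⁻¹) ↔
      ∃ k : ℕ, k < p ∧ (p : ℤ) ∣ (k : ℤ) ^ 2 + tB * k + nB := by
  have hpr : (0 : ℝ) < p := by exact_mod_cast hp.out.pos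
  have hp1 : (1 : ℝ) < p := by exact_mod_cast hp.out.one_lt
  have hpi1 : (p : ℝ)⁻¹ < 1 := inv_lt_one_of_one_lt₀ hp1
  have hpi1' : (p : ℝ)⁻¹ ≤ 1 := hpi1.le
  constructor
  · rintro ⟨c, hc, hcn⟩
    obtain ⟨r, s, hrs⟩ :=
      exists_rat_eq_of_mem_adjoin (forall_isUnit_of_padic_division H.hdivp) H.hγ ((mul_eq_mul_iff_mem_adjoin (forall_isUnit_of_padic_division H.hdivp) H.hγ).mp hc)
    rw [hrs, padicNrd_ratCoords] at hcn
    obtain ⟨u, v, hu, hv, huv⟩ := hmax r s (by rw [hcn]; exact hpi1')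
    rw [huv] at hcn
    have hcn' := hcn
    rw [norm_smul_one_add_smul, H.tr_σp, H.norm_σp] at hcn
    -- `v` is a unit
    have hv1 : ‖v‖ = 1 := by
      refine norm_eq_one_of_not_le hv fun hvp => ?_
      have hup : ‖u‖ ≤ (p : ℝ)⁻¹ := by
        rw [← norm_lt_one_iff_le_inv]
        have h1 : ‖u * v * (tB : ℚ_[p])‖ < 1 := by
          rw [norm_mul, norm_mul]
          calc ‖u‖ * ‖v‖ * ‖(tB : ℚ_[p])‖ ≤ 1 * (p : ℝ)⁻¹ * 1 := by
                gcongr; exact Padic.norm_int_le_one _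
            _ < 1 := by rw [one_mul, mul_one]; exact hpi1
        have h2 : ‖v ^ 2 * (nB : ℚ_[p])‖ < 1 := by
          rw [norm_mul, norm_pow]
          calc ‖v‖ ^ 2 * ‖(nB : ℚ_[p])‖ ≤ ((p : ℝ)⁻¹) ^ 2 * 1 := by
                gcongr; exact Padic.norm_int_le_one _
            _ < 1 := by rw [mul_one]; exact pow_lt_one₀ (by positivity) hpi1 two_ne_zero
        have hu2 : ‖u ^ 2‖ < 1 := by
          have e : u ^ 2 = (u ^ 2 + u * v * (tB : ℚ_[p]) + v ^ 2 * (nB : ℚ_[p])) -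
              (u * v * (tB : ℚ_[p]) + v ^ 2 * (nB : ℚ_[p])) := by ring
          rw [e]
          refine lt_of_le_of_lt (norm_sub_le_max _ _) (max_lt ?_ (norm_add_lt_of_lt h1 h2))
          rw [hcn]; exact hpi1
        rw [norm_pow] at hu2
        exact (pow_lt_one_iff_of_nonneg (norm_nonneg _) two_ne_zero).mp hu2
      have hle : ‖u ^ 2 + u * v * (tB : ℚ_[p]) + v ^ 2 * (nB : ℚ_[p])‖ ≤ ((p : ℝ) ^ 2)⁻¹ := by
        refine (Padic.nonarchimedean _ _).trans (max_le ((Padic.nonarchimedean _ _).trans (max_le ?_ ?_)) ?_)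
        · rw [norm_pow, ← inv_pow]; exact pow_le_pow_left₀ (norm_nonneg _) hup 2
        · rw [norm_mul, norm_mul, ← inv_pow, sq]
          calc ‖u‖ * ‖v‖ * ‖(tB : ℚ_[p])‖ ≤ (p : ℝ)⁻¹ * (p : ℝ)⁻¹ * 1 := by
                gcongr; exact Padic.norm_int_le_one _
            _ = _ := mul_one _
        · rw [norm_mul, norm_pow, ← inv_pow]
          calc ‖v‖ ^ 2 * ‖(nB : ℚ_[p])‖ ≤ ((p : ℝ)⁻¹) ^ 2 * 1 := by
                gcongr; exact Padic.norm_int_le_one _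
            _ = _ := mul_one _
      rw [hcn] at hle
      have hpp : (p : ℝ) ^ 2 ≤ p := (inv_le_inv₀ hpr (pow_pos hpr 2)).mp hle
      have hp2 : (2 : ℝ) ≤ p := by exact_mod_cast hp.out.two_le
      nlinarith
    have hv0 : v ≠ 0 := fun h0 => by rw [h0, norm_zero] at hv1; exact zero_ne_one hv1
    have e : u • (1 : Kp D ; p ; γ) + v • σp = v • (σp + (u / v) • 1) := by
      rw [smul_add, smul_smul, mul_div_cancel₀ _ hv0, add_comm]
    rw [e, norm_smul', norm_mul, norm_pow, hv1, one_pow, one_mul] at hcn'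
    have hc1 : ‖u / v‖ ≤ 1 := by rw [norm_div, hv1, div_one]; exact hu
    have hNw : ‖(σp + (u / v) • 1).norm‖ < 1 := by rw [hcn']; exact hpi1
    obtain ⟨k, hkp, hk⟩ := exists_nat_lt_norm_sub_lt_one hc1
    have hk1 : ‖(k : ℚ_[p])‖ ≤ 1 := by simpa using Padic.norm_int_le_one (p := p) (k : ℤ)
    exact ⟨k, hkp, (norm_norm_add_natCast_lt_one_iff H.tr_σp H.norm_σp k).mp
      (norm_norm_add_smul_one_lt_one_of_sub H.tr_σp hc1 hk1 hNw hk)⟩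
  · rintro ⟨k, -, hk⟩
    set y : D := algebraMap ℚ D (r₀ + (k : ℤ)) + ((m : ℚ)⁻¹) • γ with hy
    have hy0 : y ≠ 0 := by
      intro h0
      have e : algebraMap ℚ D (r₀ + (k : ℤ)) + ((m : ℚ)⁻¹) • γ = algebraMap ℚ D 0 + (0 : ℚ) • γ := by
        rw [← hy, h0, map_zero, zero_smul, add_zero]
      exact inv_ne_zero (Nat.cast_ne_zero.mpr H.hm) (rat_coords_unique H.hγ e).2
    refine ⟨((forall_isUnit_of_padic_division H.hdivp) y hy0).unit, by rw [IsUnit.unit_spec]; exact ratCoords_comm γ _ _, ?_⟩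
    rw [IsUnit.unit_spec, hy, H.padicNrd_σ₀_add]
    refine le_antisymm ?_ ?_
    · have h := (Padic.norm_int_le_pow_iff_dvd ((k : ℤ) ^ 2 + tB * k + nB) 1).mpr (by rw [pow_one]; exact hk)
      rwa [show (-((1 : ℕ) : ℤ)) = -1 by norm_num, zpow_neg_one] at h
    · by_contra hlt
      push Not at hlt
      -- `‖N‖ < p⁻¹` gives `p² ∣ N`, and then `p ∣ tr`: `B` would not be `p`-maximal
      have hle : ‖(((k : ℤ) ^ 2 + tB * k + nB : ℤ) : ℚ_[p])‖ ≤ (p : ℝ) ^ (-((2 : ℕ) : ℤ)) := by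
        rw [Padic.norm_le_pow_iff_norm_lt_pow_add_one]
        rwa [show (-((2 : ℕ) : ℤ)) + 1 = -1 by norm_num, zpow_neg_one]
      rw [Padic.norm_int_le_pow_iff_dvd] at hle
      exact (H.forall_mem_latt_iff_not_nonmax).mp hmax ⟨k, H.dvd_tr_of_dvd_norm k hk, hle⟩

/-! ### The local embedding number at a ramified prime -/

/-- **The local embedding number at a ramified prime `p` of `D`** (`O` maximal at `p`): for an
order `B ∋ γ` with `B = ℤ[σ₀]`, `σ₀² - t_B σ₀ + n_B = 0`,
`m_p(B) = 0` if `B_p` is not maximal (`∃ k, p ∣ t_B + 2k ∧ p² ∣ k² + t_B k + n_B`), and otherwise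
`m_p(B) = 2 - #{k mod p : p ∣ k² + t_B k + n_B} = 1 - (B/p)` (`2` if `p` is inert in `ℚ(γ)`,
`1` if `p` ramifies; Eichler's `1 - {B/p}`, Vignéras' `m_p = 1 - (L/p)` at `p ∣ D`). [cite: VignerasLNM800, Ch. II §3; Ch. III §5 Thm. 5.11 and Exercice 5.2] -/
theorem localEmbeddingNumber_eq
    [Decidable (∃ k : ℤ, (p : ℤ) ∣ tB + 2 * k ∧ (p : ℤ) ^ 2 ∣ k ^ 2 + tB * k + nB)] :
    localEmbeddingNumber O γ B p =
      if ∃ k : ℤ, (p : ℤ) ∣ tB + 2 * k ∧ (p : ℤ) ^ 2 ∣ k ^ 2 + tB * k + nB then 0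
      else 2 - ((Finset.range p).filter (fun k : ℕ => (p : ℤ) ∣ (k : ℤ) ^ 2 + tB * k + nB)).card := by
  split_ifs with hnm
  · apply H.localEmbeddingNumber_eq_zero
    rw [Ne, H.inf_adjoinLattice_eq_iff, not_not]
    exact hnm
  · have hmax' := (H.forall_mem_latt_iff_not_nonmax).mpr hnm
    have hmax := (H.inf_adjoinLattice_eq_iff_forall).mpr hmax'
    have hle := H.card_roots_le_one
    by_cases hroot : ∃ k : ℕ, k < p ∧ (p : ℤ) ∣ (k : ℤ) ^ 2 + tB * k + nB
    · rw [H.localEmbeddingNumber_eq_one hmax ((H.exists_padicNrd_eq_inv_iff hmax').mpr hroot)]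
      obtain ⟨k, hkp, hk⟩ := hroot
      have h1 : 0 < ((Finset.range p).filter (fun k : ℕ => (p : ℤ) ∣ (k : ℤ) ^ 2 + tB * k + nB)).card :=
        Finset.card_pos.mpr ⟨k, by rw [Finset.mem_filter, Finset.mem_range]; exact ⟨hkp, hk⟩⟩
      omega
    · rw [H.localEmbeddingNumber_eq_two hmax (fun h => hroot ((H.exists_padicNrd_eq_inv_iff hmax').mp h))]
      have h0 : ((Finset.range p).filter (fun k : ℕ => (p : ℤ) ∣ (k : ℤ) ^ 2 + tB * k + nB)).card = 0 :=
        Finset.card_eq_zero.mpr (Finset.filter_eq_empty_iff.mpr fun k hk hdk =>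
          hroot ⟨k, Finset.mem_range.mp hk, hdk⟩)
      omega

end RamHyp

end Ramified

end Brandt

end Literature.NumberTheory.Automorphic

end
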